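import Summits.BirchSwinnertonDyer.BirchSwinnertonDyer.Theorems.ByReductionTypeAtTwoOrdKatoOptimalLedger
import Summits.BirchSwinnertonDyer.BirchSwinnertonDyer.Theorems.ByReductionTypeAtTwoAnalyticMuZeroShapes
import Summits.BirchSwinnertonDyer.BirchSwinnertonDyer.Theorems.ByReductionTypeAtTwoOrdKatoHalfAtTwoIsoHintOfAbbesUllmo
import Summits.BirchSwinnertonDyer.BirchSwinnertonDyer.Theorems.ByReductionTypeAtTwoOrdKatoHalfAtTwoIsoOptimalOff514Defs
import Summits.BirchSwinnertonDyer.BirchSwinnertonDyer.Theorems.ByReductionTypeAtTwoOrdKatoHalfAtTwoIsoSignFreeDefs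
import Summits.BirchSwinnertonDyer.BirchSwinnertonDyer.Theorems.ByReductionTypeAtTwoOrdKatoHalfAtTwoIsoZetaColemanMuIotaChain
import Summits.BirchSwinnertonDyer.BirchSwinnertonDyer.Theorems.ByReductionTypeAtTwoOrdKatoHalfAtTwoIsoCoreTheoremAPosDisc
import Summits.BirchSwinnertonDyer.BirchSwinnertonDyer.Theorems.ByReductionTypeAtTwoOrdKatoHalfAtTwoIsoPosDiscSplit
import Summits.BirchSwinnertonDyer.BirchSwinnertonDyer.Theorems.ByReductionTypeAtTwoOrdKatoHalfAtTwoIsoPosDiscEpsilonDefs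
import Summits.BirchSwinnertonDyer.BirchSwinnertonDyer.Theorems.ByReductionTypeAtTwoOrdKatoHalfAtTwoIsoPosDiscEpsilon
import Summits.BirchSwinnertonDyer.BirchSwinnertonDyer.Theorems.ByReductionTypeAtTwoOrdKatoHalfAtTwoIsoPosDiscNecessity
import Summits.BirchSwinnertonDyer.BirchSwinnertonDyer.Theorems.ByReductionTypeAtTwoOrdKatoHalfAtTwoIsoPosDiscNecessityTwist
import Summits.BirchSwinnertonDyer.BirchSwinnertonDyer.Theorems.ByReductionTypeAtTwoOrdKatoHalfAtTwoIsoGreenbergMuDefs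
import Summits.BirchSwinnertonDyer.Rank1Residual.GreenbergMuConjecture
import Summits.BirchSwinnertonDyer.BirchSwinnertonDyer.Theorems.ByReductionTypeAtTwoOrdKatoHalfAtTwoIsoColemanHalfClassCells
import Summits.BirchSwinnertonDyer.BirchSwinnertonDyer.Theorems.ByReductionTypeAtTwoOrdKatoHalfAtTwoIsoColemanHalfClassOff514
import Summits.BirchSwinnertonDyer.BirchSwinnertonDyer.Theorems.ByReductionTypeAtTwoOrdKatoHalfAtTwoIsoPosDiscRealSignature
import Summits.BirchSwinnertonDyer.BirchSwinnertonDyer.Theorems.ByReductionTypeAtTwoOrdKatoHalfAtTwoIsoPosDiscSmallCarrier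
import Summits.BirchSwinnertonDyer.BirchSwinnertonDyer.Theorems.ByReductionTypeAtTwoOrdKatoHalfAtTwoIsoRelaxedRoadsLemma46
import Summits.BirchSwinnertonDyer.BirchSwinnertonDyer.Theorems.ByReductionTypeAtTwoOrdKatoHalfAtTwoIsoConjATwoOfPointFieldMu
import Summits.BirchSwinnertonDyer.BirchSwinnertonDyer.Theorems.ByReductionTypeAtTwoOrdKatoHalfAtTwoIsoZetaColemanMuIotaKatoCarriers
import Summits.BirchSwinnertonDyer.BirchSwinnertonDyer.Theorems.ByReductionTypeAtTwoOrdKatoHalfAtTwoIsoColemanMuSpanFreeKatoCarriers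
import Literature.NumberTheory.EllipticCurves.Kato2004.LocalIwasawaCohomologyTateDuality
import Summits.BirchSwinnertonDyer.BirchSwinnertonDyer.Theorems.ByReductionTypeAtTwoOrdKatoHalfAtTwoIsoColemanMuFreeValue
import Literature.NumberTheory.EllipticCurves.Kato2004.LocalIwasawaCohomologyOrdinaryQuotient
import Literature.NumberTheory.EllipticCurves.FineSelmerLimThm35AtTwoUpstairsProofs
import Summits.BirchSwinnertonDyer.BirchSwinnertonDyer.Theorems.ByReductionTypeAtTwoOrdKatoHalfAtTwoIsoSteinbergDefs
import Summits.BirchSwinnertonDyer.BirchSwinnertonDyer.Theorems.ByReductionTypeAtTwoOrdKatoHalfAtTwoIsoOmegaRoadDefs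
import Summits.BirchSwinnertonDyer.BirchSwinnertonDyer.Theorems.ByReductionTypeAtTwoOrdKatoHalfAtTwoIsoChebotarevTranspositionTwo
import Summits.BirchSwinnertonDyer.BirchSwinnertonDyer.Theorems.ByReductionTypeAtTwoOrdKatoHalfAtTwoIsoSelmerSideTwo
import Summits.BirchSwinnertonDyer.BirchSwinnertonDyer.Theorems.ByReductionTypeAtTwoOrdKatoHalfAtTwoIsoKolyvaginRankOneTwo
import Summits.BirchSwinnertonDyer.Rank1Residual.X10.CoreTheoremAOddPrime
import Summits.BirchSwinnertonDyer.Rank1Residual.X5.KatoOrdTwoMuPart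
import Summits.BirchSwinnertonDyer.Rank1Residual.X5.TwoAdicImageCriteriaLift
import Literature.NumberTheory.EllipticCurves.Kato2004.EulerSystemBoundFineSelmerTwo
import Literature.NumberTheory.EllipticCurves.TwoAdicImageGoodOrdinaryAtTwoProofs
import Literature.NumberTheory.EllipticCurves.PAdicLFunctionIntegralityAtTwoAutoProofs
import Literature.NumberTheory.EllipticCurves.NonEisensteinPrimeOfSurjective
import Literature.NumberTheory.EllipticCurves.IwasawaAlgebraInvolution
import HarnessLib
import Summits.BirchSwinnertonDyer.BirchSwinnertonDyer.Theorems.ByReductionTypeAtTwoOrdKatoHalfAtTwoIsoMuFreeValueNegOfGreenbergMu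
/-!
# Cert54a — crux-triage r1 seat 2, GEN 54 (2026-08-29): KERNEL-EXACT vet of the registered `Δ < 0` memo stub of skeleton v24
# (`4921f2ec…`) against cruxlead-19573-w3 g7's LANDED split doors (p736704 + p737300), in the SKELETON'S OWN name-resolution context

Crux `ByReductionTypeAtTwo.OrdKatoHalfAtTwoIso` (stmt-BirchSwinnertonDyer-19573), PICKED line `steinberg-fibre-at-two`.
This is the successor of GEN 53's unpublished `Cert53b.lean` (key K7: the farm had not built the doors module at 18:08–18:27Z, rc 75 ×4;
built by 18:45Z — `Probe54.lean` rc 0). Imports = the 40 imports of `Lines/steinberg_fibre_at_two.lean` v24 VERBATIM + the doors module;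
`open` block = the skeleton's ll. 344–361 VERBATIM; namespace = the skeleton's. Hence every pasted LEDGER text below elaborates exactly as the
registered stub does inside the skeleton (same opens, same namespace, same instance context).

CONTENT (all theorems are one-line compositions BY NAME with landed doors; no `sorry`, no new definition of mathematical content — the four
`…Registered` defs are the LEDGER texts of v24's registered stubs pasted verbatim, `workitem get` 2026-08-29T18:40Z):
* `vflatNegRegistered_of_doors` : PT-exact (p729889) → PUB → G11⁻ → MU13⁻ → V♭⁻(registered text)           [(⇐) door, `exact` = definitional match]
* `g11neg_of_v24_registered` / `mu13neg_of_v24_registered` : v24's registered cite stubs (`stub_tateDualityTower`, `stub_ordKernelFunctional`,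
  `stub_bundle`.1) + V♭⁻(registered) → G11⁻, resp. (+ Kato 12.4 (2) `thm12_4`) → MU13⁻                       [(⇒) doors]
* `vflatNegRegistered_iff_split` : the iff BY NAME on the registered text                                        [lossless re-cut, kernel-exact]
* `cruxNegDiscOntoCell_of_v24_registered` : v24's registered Δ < 0 inputs close the crux's Δ < 0 ONTO cell through LANDED doors only, `W′ := W`,
  via G11⁻ and the sign-free direct road (no F1μι⁻ packaging)                                                      [§B (b′) for option (b)/(c)]
* `g11negHabitat_of_crux` : necessity BY NAME (crux + PUB + Cassels + AU ⟹ G11⁻ on the habitat slice).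
HONEST STATUS: nothing here asserts V♭⁻, G11⁻, MU13⁻, PT-exact, PUB or the crux; every theorem is an implication between displayed OPEN
statements; BSD is NOT proved; crux 202 is OPEN; skeleton v24 is untouched (this file is NOT a skeleton and registers nothing).
-/

set_option autoImplicit false
set_option linter.dupNamespace false

noncomputable section

open scoped Classical MatrixGroups ModularForm NumberField
open CongruenceSubgroup WeierstrassCurve Field IsDedekindDomain
open Literature.NumberTheory.GaloisRepresentations
open Literature.NumberTheory.EllipticCurves Literature.NumberTheory.EllipticCurves.ModularForms
open Literature.NumberTheory.EllipticCurves.Kato2004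
  Literature.NumberTheory.EllipticCurves.Kato2004.EulerSystemValues
open Literature.NumberTheory.EllipticCurves.Rank1Residual
open Summit.BirchSwinnertonDyer.BirchSwinnertonDyer.Theorems.Rank1ResidualX1Defs
  Summit.BirchSwinnertonDyer.BirchSwinnertonDyer.Rank1Residual
open Summit.BirchSwinnertonDyer.Rank1Residual Summit.BirchSwinnertonDyer.Rank1Residual.X5
open Summit.BirchSwinnertonDyer.BirchSwinnertonDyer.Theorems.OrdKatoOptimalAtTwo
  Summit.BirchSwinnertonDyer.BirchSwinnertonDyer.Theorems.OrdKatoIntAtTwo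
open Summit.BirchSwinnertonDyer.BirchSwinnertonDyer.Theses.ByReductionTypeAtTwo
open Summit.BirchSwinnertonDyer.BirchSwinnertonDyer.Theorems.SteinbergFibreAtTwo
open Literature.NumberTheory.EllipticCurves.Greenberg1999 Literature.NumberTheory.IwasawaTheory
open Literature.NumberTheory.GaloisCohomology Literature.NumberTheory.EllipticCurves.GreenbergSelmer
  Literature.NumberTheory.EllipticCurves.IwasawaDual


namespace Summit.BirchSwinnertonDyer.BirchSwinnertonDyer.Cruxes.OrdKatoHalfAtTwoIso.SteinbergFibreAtTwo

namespace Cert54a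

/-- LEDGER text of the registered stub `stub_muFreeValue_negDisc_two` (V♭⁻) of skeleton v24 `4921f2ec…`, pasted VERBATIM (1181 chars normalised). -/
def VflatNegRegistered : Prop :=
  ∀ (W : WeierstrassCurve ℚ) [W.IsElliptic] [W.IsGloballyMinimal] [ContinuousSMul ℤ_[2] (W.tateModule 2)] [Module.Free ℤ_[2] (W.tateModule 2)] [Module.Finite ℤ_[2] (W.tateModule 2)] {N : ℕ} [NeZero N] (f : CuspForm (Gamma0 N) 2) (κ : ZpExtension ℚ 2) (γ : absoluteGaloisGroup ℚ) (hκ : κ.IsCyclotomic) (hγ : κ.IsTopGenerator γ), W.Δ < 0 → IsOrdinaryAt W 2 → W.HasSurjectiveModNGaloisRep 2 → IsCyclotomicVariable 2 γ → IsNewformOf W f → ∀ (v₂ : HeightOneSpectrum (𝓞 ℚ)) (_ : ((2 : ℕ) : 𝓞 ℚ) ∈ v₂.asIdeal) (γᵥ : absoluteGaloisGroup (v₂.adicCompletion ℚ)) (hsurj : Function.Surjective (κ.toContinuousMonoidHom.comp (resGalOfEmb (closureEmb (K := ℚ) (v₂.adicCompletion ℚ))))) (hγᵥ : κ.IsTopGenerator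 (resGalOfEmb (closureEmb (K := ℚ) (v₂.adicCompletion ℚ)) γᵥ)) (I : IwasawaH1Data W 2 κ γ) (J : LocalIwasawaH1Data κ v₂ ((tateRep W 2).toLocal v₂) γᵥ) (J' : LocalIwasawaH1Data κ v₂ (tateLocalOrdinaryRep W 2 v₂) γᵥ) (col : J.H →ₗ[IwasawaAlgebra 2] IwasawaAlgebra 2), (∀ x : J.H, col x = 0 ↔ x ∈ LinearMap.range (J'.ordinaryInclusion J)) → (∃ x : J.H, col x ∉ IwasawaAlgebra.augIdealP 2) → ∃ g : I.H, IsEulerSystemClassTwo W hκ I g ∧ col (I.loc J hsurj hγ hγᵥ g) ∉ IwasawaAlgebra.augIdealP 2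

/-- LEDGER text of the registered stub `stub_bundle` of v24, VERBATIM. -/
def BundleRegistered : Prop :=
  Literature.Uncategorized.OrdPublishedInputsAtTwo ∧ abbesUllmo_not_dvd_maninConstant_of_not_dvd_level ∧ Literature.NumberTheory.EllipticCurves.Greenberg1999.prop514_isTorsion_mu_eq_zero_two

/-- LEDGER text of the registered stub `stub_tateDualityTower` of v24, VERBATIM. -/
def TateDualityTowerRegistered : Prop :=
  exists_lambdaAdicLocalTatePairing_selmer_orthogonal

/-- LEDGER text of the registered stub `stub_ordKernelFunctional` of v24, VERBATIM. -/
def OrdKernelFunctionalRegistered : Prop :=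
  exists_ordinaryKernelFunctional

/-- LEDGER text of the registered stub `stub_greenbergMu_two_posDisc` (G11⁺) of v24, VERBATIM. -/
def GreenbergPosRegistered : Prop :=
  GreenbergMuZeroTwoOrdPosDisc

/-- The three short registered texts ARE the Literature / Theorems names (definitional unfolding; kernel check of name resolution in the
skeleton's context). -/
theorem tateDualityTowerRegistered_iff : TateDualityTowerRegistered ↔ exists_lambdaAdicLocalTatePairing_selmer_orthogonal := Iff.rfl

theorem ordKernelFunctionalRegistered_iff : OrdKernelFunctionalRegistered ↔ exists_ordinaryKernelFunctional := Iff.rfl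

theorem greenbergPosRegistered_iff : GreenbergPosRegistered ↔ GreenbergMuZeroTwoOrdPosDisc := Iff.rfl

theorem bundleRegistered_pub (hB : BundleRegistered) : OrdPublishedInputsAtTwo := hB.1

theorem bundleRegistered_abbesUllmo (hB : BundleRegistered) : abbesUllmo_not_dvd_maninConstant_of_not_dvd_level := hB.2.1

/-- **(⇐) KERNEL-EXACT**: the landed door's conclusion IS the registered text — `exact` with no rewriting. PT-exact (p729889) + PUB + G11⁻ + MU13⁻
⟹ V♭⁻ as REGISTERED. [cite: Kato2004Asterisque, §17.13 (17.13.1)–(17.13.3) (pp. 279–280)] -/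
theorem vflatNegRegistered_of_doors (hPT : exists_lambdaAdicLocalTatePairing_poitouTate_exact) (hPub : OrdPublishedInputsAtTwo)
    (hG : GreenbergMuZeroTwoOrdNegDisc) (hZ : ZetaQuotientMuZeroTwoOrdNegDisc) : VflatNegRegistered :=
  muFreeValue_negDisc_of_greenbergMuNeg_of_zetaQuotientMu hPT hPub hG hZ

/-- **(⇒, first half) over v24's OWN registered cite stubs**: `stub_tateDualityTower` + `stub_ordKernelFunctional` + `stub_bundle`.1 (PUB) +
V♭⁻(registered) ⟹ G11⁻ (Greenberg's Conjecture 1.11 at `2` on the `Δ < 0` onto good-ordinary cell, RANK-FREE). So the registered `Δ < 0`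
content of v24 CONTAINS the published conjecture G11⁻. [cite: GreenbergLNM1716, Conj. 1.11 (p. 64)] -/
theorem g11neg_of_v24_registered (hT : TateDualityTowerRegistered) (hOK : OrdKernelFunctionalRegistered) (hB : BundleRegistered)
    (hV : VflatNegRegistered) : GreenbergMuZeroTwoOrdNegDisc :=
  greenbergMuZeroTwoOrdNegDisc_of_muFreeValue_negDisc hT hOK hB.1 hV

/-- **(⇒, second half)**: Kato Thm. 12.4 (2) (`thm12_4`, print, every `p`) + `stub_ordKernelFunctional` + `stub_bundle`.1 + V♭⁻(registered) ⟹ MU13⁻.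
[cite: Kato2004Asterisque, Thm. 12.4 (2) (p. 221)] -/
theorem mu13neg_of_v24_registered (h12 : thm12_4) (hOK : OrdKernelFunctionalRegistered) (hB : BundleRegistered)
    (hV : VflatNegRegistered) : ZetaQuotientMuZeroTwoOrdNegDisc :=
  zetaQuotientMuZeroTwoOrdNegDisc_of_muFreeValue_negDisc h12 hOK hB.1 hV

/-- **The lossless re-cut on the REGISTERED text, kernel-exact**: V♭⁻(registered) ⟺ G11⁻ ∧ MU13⁻ modulo {PT-exact p729889, p727215, `thm12_4`, PUB}. -/
theorem vflatNegRegistered_iff_split (hPT : exists_lambdaAdicLocalTatePairing_poitouTate_exact)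
    (hOK : exists_ordinaryKernelFunctional) (h12 : thm12_4) (hPub : OrdPublishedInputsAtTwo) :
    VflatNegRegistered ↔ (GreenbergMuZeroTwoOrdNegDisc ∧ ZetaQuotientMuZeroTwoOrdNegDisc) :=
  muFreeValue_negDisc_iff_greenbergMuNeg_and_zetaQuotientMu hPT hOK h12 hPub

/-- **v24's registered `Δ < 0` inputs close the crux's `Δ < 0` ONTO cell through LANDED doors only, `W′ := W`** — via G11⁻ and the sign-free
direct road `ordKatoHalfAtTwoIso_negDisc_of_greenbergMuNeg` (no F1μι⁻ packaging, no Coleman map): registered {`stub_tateDualityTower`,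
`stub_ordKernelFunctional`, `stub_bundle`.1 + .2.1, V♭⁻} suffice; `stub_bundle`.2.2 (Prop. 5.14 at `2`) is NOT used.
[cite: GreenbergLNM1716, Conj. 1.11 (p. 64)] [cite: Kato2004Asterisque, Thm. 17.4 (1)(2) (p. 273)] [cite: AbbesUllmo1996, Thm. A] -/
theorem cruxNegDiscOntoCell_of_v24_registered (hT : TateDualityTowerRegistered) (hOK : OrdKernelFunctionalRegistered)
    (hB : BundleRegistered) (hV : VflatNegRegistered) :
    ∀ (W : WeierstrassCurve ℚ) [W.IsElliptic] [W.IsGloballyMinimal], ¬ W.HasCM → W.analyticRank = 0 → GoodOrd W 2 →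
      W.HasSurjectiveModNGaloisRep 2 → W.Δ < 0 →
      ∃ (W' : WeierstrassCurve ℚ) (_ : W'.IsElliptic) (_ : W'.IsGloballyMinimal),
        IsIsogenous W W' ∧ O1.MainConjectureLowerDivisibilityAtTwoOrd W' := by
  obtain ⟨_, -, h17, -⟩ := hB.1
  exact ordKatoHalfAtTwoIso_negDisc_of_greenbergMuNeg (g11neg_of_v24_registered hT hOK hB hV) hB.2.1
    h17

/-- **NECESSITY BY NAME**: the crux + PUB + Cassels + Abbes–Ullmo ⟹ G11⁻ on the HABITAT slice (non-CM, analytic rank `0`) — the part of the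
rank-free G11⁻ that the crux actually needs. [cite: GreenbergLNM1716, §1 Conj. 1.11 (p. 64)] [cite: MilneADT2006, Thm. I.7.3 (Cassels)] -/
theorem g11negHabitat_of_crux (hcrux : OrdKatoHalfAtTwoIso) (hB : BundleRegistered) (hCassels : bsdRHS_eq_of_isIsogenous) :
    ∀ (W : WeierstrassCurve ℚ) [W.IsElliptic] [W.IsGloballyMinimal],
      ¬ W.HasCM → W.analyticRank = 0 → GoodOrd W 2 → W.HasSurjectiveModNGaloisRep 2 → W.Δ < 0 →
      ∀ (κ : ZpExtension ℚ 2) (γ : absoluteGaloisGroup ℚ), κ.IsCyclotomic → κ.IsTopGenerator γ →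
        IsCyclotomicVariable 2 γ → ∀ D : W.SelmerDualData κ γ, D.mu = 0 :=
  greenbergMuZeroTwoOrdNegDisc_habitat_of_ordKatoHalfAtTwoIso hcrux hB.1 hCassels hB.2.1

#print axioms vflatNegRegistered_of_doors
#print axioms vflatNegRegistered_iff_split
#print axioms cruxNegDiscOntoCell_of_v24_registered
#print axioms g11negHabitat_of_crux

end Cert54a

end Summit.BirchSwinnertonDyer.BirchSwinnertonDyer.Cruxes.OrdKatoHalfAtTwoIso.SteinbergFibreAtTwo

end
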